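import Literature.Analysis.FluidPDE.NSEnstrophyPersistenceForced
import Literature.Analysis.FluidPDE.TaoForcedBoundedSobolevNorms
import Literature.Analysis.FluidPDE.TaoH1LocalExistenceForced
import Literature.Analysis.FluidPDE.ClassicalSobolevUniqueness
import Literature.Analysis.FluidPDE.ClassicalSolutionGlue
import Literature.Analysis.FluidPDE.ClayForceTimeShift
import Literature.Analysis.FluidPDE.NormalisedPressureL2Finite
import Literature.Analysis.FluidPDE.ForcePotentialL2Bound
import Literature.Analysis.FluidPDE.EnstrophyGronwall
import HarnessLib

/-!
# Tao 2013, Cor. 11.1 + Cor. 4.3 + Thm. 5.4 (iv) WITH force: the named fact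
# `tao2011_hasBoundedSobolevNormsOn_forced` from forced smooth local existence

Analysis/FluidPDE proof file (cell `pub/ns-blowup`, seat `ns-blowup-lit` g10; bears_on the Literature
leaf J1 `tao2011_hasBoundedSobolevNormsOn_forced` (`TaoForcedBoundedSobolevNorms.lean`) consumed by
the E–C lane (`DesignedBlowupSerrinDivergence`), and the forced local-existence leaf F2
`tao2011_smooth_local_existence_forced` (`TaoH1LocalExistenceForced.lean`) whose Fourier-side
discharge is in flight; WHAT THIS IS NOT: not a statement about Navier–Stokes regularity or
blow-up — regularity bookkeeping of a GIVEN classical solution on a closed slab, modulo ONE named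
fact taken as a hypothesis). No definitions, no named facts:

* `tao2011_hasBoundedSobolevNormsOn_forced_of_smooth_local_existence :
    tao2011_smooth_local_existence_forced → tao2011_hasBoundedSobolevNormsOn_forced`.

So J1 becomes a theorem the day F2 does (the tree's planned `…_forced_holds` of the forced
Fourier–Picard port, seats lean2 / ecbridge-7 / lit / lit2 / lit3).

## The argument (Tao 2013, proof of Thm. 5.4 (iv) and Cor. 11.1, arXiv pp. 18 and 36)

Let `(u, p)` be classical on `[0, T] × ℝ³` (`ν > 0`) with finite energy, Schwartz datum, Clay force
`f` and Tao's normalised pressure `p = -Δ⁻¹∂ᵢ∂ⱼ(uᵢuⱼ) + Δ⁻¹∇·f`.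

1. SPATIAL clause (a theorem of the tree, `IsClassicalNSSolutionOn.hasBoundedSobolevNormsOn_of_clayForce`,
   `NSEnstrophyPersistenceForced.lean`): `u ∈ L^∞_t H^k_x([0,T])` for every `k`. In particular
   `‖u(t)‖_{H¹} ≤ A` uniformly, and (`linfty_bound_of_hasBoundedSobolevNormsOn_holds`) `|u| ≤ M`.
2. UNIFORM RESTART. The force is Schwartz on every slab with `‖f(t)‖_{H¹} ≤ B` for `t ≥ 0`
   (`HasRapidSpaceTimeDecay.exists_lintegral_iteratedFDeriv_slice_sq_le_all`). Choose ONE step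
   `h = T/N` with `(A + Bh)⁴h ≤ cν³`. On each `[kh, (k+1)h]` the forced local existence theorem F2,
   applied to the datum `u(kh)` (smooth, divergence free, `H^∞` by 1.) and the shifted force
   `f(· + kh)` (Schwartz on `[0, h]`, `ClayForceTimeShift`), produces a classical `(ũ, p̃)` on
   `[0, h]` with `ũ, ∂ₜũ, p̃ ∈ L^∞_t H^k_x`; by uniqueness of classical solutions with bounded Sobolev
   norms (`IsClassicalNSSolutionOn.velocity_eq_of_hasBoundedSobolevNormsOn`, fact-free) `ũ` IS the
   shifted flow `u(· + kh)`.
3. `∂ₜu` clause: on `[kh, (k+1)h]` the one-sided derivative within `[0, T]` is the one within the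
   sub-slab (`IsSmoothSpaceTimeOn.timeDerivWithin_eq_of_subset`), which is `∂ₜũ` shifted
   (`timeDerivWithin_comp_add_right`); finitely many pieces.
4. PRESSURE clause, orders `n ≥ 1`: the velocity and the force determine `∇p` through the momentum
   equation, so `∇p(t) = ∇p̃(t - kh)` and `‖Dⁿ⁺¹p(t)‖_{L²} = ‖Dⁿ(∇p̃)‖_{L²}` is bounded by the piece.
   Order `0` (this is where the NORMALISATION enters — `p̃` is only determined up to `c(t)`):
   `‖-Δ⁻¹∂ᵢ∂ⱼ(uᵢuⱼ)(t)‖_{L²} ≤ 27M_λ ‖|u(t)|²‖_{L²} ≤ 27M_λ M ‖u(t)‖_{L²}` (Stein's `L²` bound,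
   `eLpNorm_normalisedPressure_le_of_integrable`) and `‖Δ⁻¹∇·f(t)‖_{L²} ≤ ‖κ₁‖₁‖f(t)‖₂ + ‖f(t)‖₁‖κ₂‖₂`
   (Young, `eLpNorm_forcePotential_le`), both uniform on `[0, T]` by the Clay decay of `f`.

## Mathlib / tree search

Tree (`lean search`, all reused by name): `IsClassicalNSSolutionOn.hasBoundedSobolevNormsOn_of_clayForce`,
`HasRapidSpaceTimeDecay.exists_lintegral_iteratedFDeriv_slice_sq_le_all`,
`IsSmoothOnHalfSpace.norm_iteratedFDeriv_slice_le` (`NSEnstrophyPersistenceForced`);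
`IsClassicalNSSolutionOn.velocity_eq_of_hasBoundedSobolevNormsOn` (`ClassicalSobolevUniqueness`);
`IsClassicalNSSolutionOn.comp_add_right`, `timeDerivWithin_comp_add_right` (`ClassicalSolutionGlue`);
`IsClassicalNSSolutionOn.mono`, `IsSmoothSpaceTimeOn.timeDerivWithin_eq_of_subset`
(`ClassicalSolution`); `IsSmoothOnHalfSpace.isSmoothSpaceTimeOn_Icc_timeShift`,
`HasRapidSpaceTimeDecay.hasUniformRapidDecayOn_Icc_timeShift` (`ClayForceTimeShift`);
`linfty_bound_of_hasBoundedSobolevNormsOn_holds` (`TaoLocalisationProofs`);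
`eLpNorm_normalisedPressure_le_of_integrable`, `aestronglyMeasurable_normalisedPressure_of_integrable`
(`NormalisedPressureL2Finite`); `eLpNorm_forcePotential_le`, `integrable_forceMajorant_near`,
`memLp_forceMajorant_far`, `aestronglyMeasurable_forcePotential` (`ForcePotentialL2Bound`);
`ofReal_frobeniusNormSq_le_three_mul_enorm_sq` (`EnstrophyGronwall`). `lean search
'hasBoundedSobolevNormsOn_forced_of'`: only the fact-free spatial clause above. Mathlib:
`norm_iteratedFDeriv_fderiv`, `eLpNorm_add_le`, `eLpNorm_le_mul_eLpNorm_of_ae_le_mul`,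
`finite_integral_one_add_norm`, `integrable_one_add_norm`, `Nat.floor`.

## References

* T. Tao, *Localisation and compactness properties of the Navier–Stokes global regularity
  problem*, Anal. PDE 6 (2013) 25–107 = arXiv:1108.1165: Cor. 11.1 (arXiv Cor. 68, p. 36), Cor. 4.3
  (arXiv Cor. 26), Thm. 5.4 (ii)+(iv) (arXiv Thm. 31, p. 18) with the note closing its proof, and the
  normalised pressure (9). [`Tao2011`]
* E. M. Stein, *Singular Integrals and Differentiability Properties of Functions*, PUP 1970,
  Ch. II §4.2 Thm. 3. [`Stein1971`]
* D. Gilbarg, N. Trudinger, *Elliptic PDE of Second Order*, (2.12)–(2.14). [`GilbargTrudinger2001`]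
-/

noncomputable section

open MeasureTheory Set Function Filter Topology
open scoped ENNReal NNReal ContDiff

namespace Literature.Analysis.FluidPDE

namespace TaoForcedJ1

variable {ν T : ℝ} {f u : ℝ → EuclideanSpace ℝ (Fin 3) → EuclideanSpace ℝ (Fin 3)}
  {p : ℝ → EuclideanSpace ℝ (Fin 3) → ℝ}

/-! ### Plumbing: shifted flows on sub-slabs -/

/-- **The shifted flow on a sub-slab is classical**: for `[τ, τ + h] ⊆ [0, T]`, `h > 0`,
`s ↦ (u, p)(s + τ)` is a classical solution on `[0, h]` with force `s ↦ f(s + τ)` (autonomy +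
restriction of the time set). [cite: Tao2011, Thm. 5.4 proof (arXiv Thm. 31, p. 18)] -/
theorem shift_Icc (hsol : IsClassicalNSSolutionOn (Icc 0 T) ν f u p) {τ h : ℝ} (hτ : 0 ≤ τ)
    (hh : 0 < h) (hτh : τ + h ≤ T) :
    IsClassicalNSSolutionOn (Icc 0 h) ν (fun s => f (s + τ)) (fun s => u (s + τ))
      (fun s => p (s + τ)) :=
  (hsol.comp_add_right τ).mono
    (fun s hs => show s + τ ∈ Icc 0 T from ⟨by linarith [hs.1], by linarith [hs.2]⟩)
    (uniqueDiffOn_Icc hh)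

/-- Bounded Sobolev norms pass to the shifted flow on a sub-slab. [cite: Tao2011, Thm. 5.4 proof (arXiv Thm. 31, p. 18)] -/
theorem hasBoundedSobolevNormsOn_shift (hub : HasBoundedSobolevNormsOn (Icc 0 T) u) {τ h : ℝ}
    (hτ : 0 ≤ τ) (hτh : τ + h ≤ T) :
    HasBoundedSobolevNormsOn (Icc 0 h) (fun s => u (s + τ)) := by
  intro n
  obtain ⟨C, hC⟩ := hub n
  exact ⟨C, fun s hs => hC (s + τ) ⟨by linarith [hs.1], by linarith [hs.2]⟩⟩

/-- The translated sub-slab: `(· + τ)⁻¹' [τ, τ + h] = [0, h]`. [folklore] -/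
private theorem preimage_add_Icc (τ h : ℝ) : (fun s : ℝ => s + τ) ⁻¹' Icc τ (τ + h) = Icc 0 h := by
  ext s
  simp only [mem_preimage, mem_Icc]
  constructor
  · rintro ⟨h1, h2⟩; exact ⟨by linarith, by linarith⟩
  · rintro ⟨h1, h2⟩; exact ⟨by linarith, by linarith⟩

/-- **The one-sided time derivative within `[0, T]` on a sub-slab is the shifted derivative of the
shifted flow**: for `t ∈ [τ, τ + h] ⊆ [0, T]` and any `ũ` agreeing with `s ↦ u(s + τ)` on `[0, h]`,
`∂ₜ|_{[0,T]} u(t) = ∂ₜ|_{[0,h]} ũ(t - τ)`. [cite: Tao2011, Thm. 5.4 proof (arXiv Thm. 31, p. 18)] -/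
theorem timeDerivWithin_eq_shift (hu : IsSmoothSpaceTimeOn (Icc 0 T) u) {τ h : ℝ} (hτ : 0 ≤ τ)
    (hh : 0 < h) (hτh : τ + h ≤ T) {v : ℝ → EuclideanSpace ℝ (Fin 3) → EuclideanSpace ℝ (Fin 3)}
    (hv : ∀ s ∈ Icc 0 h, u (s + τ) = v s) {t : ℝ} (ht : t ∈ Icc τ (τ + h)) :
    timeDerivWithin (Icc 0 T) u t = timeDerivWithin (Icc 0 h) v (t - τ) := by
  funext x
  have hsub : Icc τ (τ + h) ⊆ Icc 0 T := Icc_subset_Icc hτ hτh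
  have e1 : timeDerivWithin (Icc τ (τ + h)) u t x = timeDerivWithin (Icc 0 T) u t x :=
    hu.timeDerivWithin_eq_of_subset hsub (uniqueDiffOn_Icc (by linarith)) ht x
  have e2 := timeDerivWithin_comp_add_right (Icc τ (τ + h)) u τ (t - τ) x
  rw [preimage_add_Icc, sub_add_cancel] at e2
  have hts : t - τ ∈ Icc 0 h := ⟨by linarith [ht.1], by linarith [ht.2]⟩
  have e3 : timeDerivWithin (Icc 0 h) (fun s => u (s + τ)) (t - τ) x =
      timeDerivWithin (Icc 0 h) v (t - τ) x := by
    simp only [timeDerivWithin_apply]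
    exact derivWithin_congr (fun s hs => congrFun (hv s hs) x) (congrFun (hv _ hts) x)
  rw [← e1, ← e2, e3]

/-- **The velocity and the force determine the pressure gradient**: two classical solutions on the
same time set of unique differentiability with the same force and the SAME velocity on that set
have the same `∇ₓp` there (subtract the momentum equations). [cite: Tao2011, (9) and Thm. 5.4 proof (arXiv Thm. 31, p. 18)] -/
theorem fderiv_pressure_eq {S : Set ℝ} {g u₁ u₂ : ℝ → EuclideanSpace ℝ (Fin 3) → EuclideanSpace ℝ (Fin 3)}
    {p₁ p₂ : ℝ → EuclideanSpace ℝ (Fin 3) → ℝ} (h₁ : IsClassicalNSSolutionOn S ν g u₁ p₁)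
    (h₂ : IsClassicalNSSolutionOn S ν g u₂ p₂) (heq : ∀ s ∈ S, u₁ s = u₂ s) {s : ℝ} (hs : s ∈ S) :
    fderiv ℝ (p₁ s) = fderiv ℝ (p₂ s) := by
  funext x
  have hd : timeDerivWithin S u₁ s x = timeDerivWithin S u₂ s x := by
    simp only [timeDerivWithin_apply]
    exact derivWithin_congr (fun r hr => congrFun (heq r hr) x) (congrFun (heq s hs) x)
  have hm₁ := h₁.momentum s hs x
  have hm₂ := h₂.momentum s hs x
  rw [hd, heq s hs] at hm₁
  have hg : gradient (p₁ s) x = gradient (p₂ s) x := by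
    have h12 := hm₁.symm.trans hm₂
    simpa using h12
  unfold gradient at hg
  exact (InnerProductSpace.toDual ℝ (EuclideanSpace ℝ (Fin 3))).symm.injective hg

/-- Equal first derivatives give equal `L²` norms of all HIGHER derivatives
(`‖Dⁿ⁺¹q‖ = ‖Dⁿ(Dq)‖`, Mathlib `norm_iteratedFDeriv_fderiv`). [folklore] -/
private theorem lintegral_iteratedFDeriv_succ_eq_of_fderiv_eq {q₁ q₂ : EuclideanSpace ℝ (Fin 3) → ℝ}
    (h : fderiv ℝ q₁ = fderiv ℝ q₂) (n : ℕ) :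
    ∫⁻ x, ‖iteratedFDeriv ℝ (n + 1) q₁ x‖ₑ ^ 2 = ∫⁻ x, ‖iteratedFDeriv ℝ (n + 1) q₂ x‖ₑ ^ 2 :=
  lintegral_congr fun x => by
    rw [← ofReal_norm, ← ofReal_norm, ← norm_iteratedFDeriv_fderiv,
      ← norm_iteratedFDeriv_fderiv, h]

/-! ### Plumbing: covering `[0, T]` by `N` steps of length `h = T / N` -/

/-- Every `t ∈ [0, Nh]` (`N ≥ 1`, `h > 0`) lies in some `[kh, (k+1)h]`, `k < N`. [folklore] -/
private theorem exists_step {h : ℝ} (hh : 0 < h) {N : ℕ} (hN : 0 < N) {t : ℝ}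
    (ht : t ∈ Icc 0 ((N : ℝ) * h)) :
    ∃ k : Fin N, t ∈ Icc ((k : ℕ) * h) (((k : ℕ) + 1) * h) := by
  rcases lt_or_eq_of_le ht.2 with hlt | heq
  · have hth : 0 ≤ t / h := div_nonneg ht.1 hh.le
    set k := ⌊t / h⌋₊ with hk
    have hk1 : (k : ℝ) ≤ t / h := Nat.floor_le hth
    have hk2 : t / h < (k : ℝ) + 1 := Nat.lt_floor_add_one _
    have hkN : k < N := by
      have : (k : ℝ) < N := lt_of_le_of_lt hk1 (by rwa [div_lt_iff₀ hh])
      exact_mod_cast this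
    refine ⟨⟨k, hkN⟩, ?_, ?_⟩
    · have := mul_le_mul_of_nonneg_right hk1 hh.le
      rwa [div_mul_cancel₀ _ hh.ne'] at this
    · have := mul_le_mul_of_nonneg_right hk2.le hh.le
      rwa [div_mul_cancel₀ _ hh.ne'] at this
  · refine ⟨⟨N - 1, Nat.sub_lt hN one_pos⟩, ?_, ?_⟩
    · have hc : ((N - 1 : ℕ) : ℝ) = N - 1 := by
        rw [Nat.cast_sub (Nat.one_le_of_lt hN), Nat.cast_one]
      simp only [hc]
      rw [heq]; nlinarith
    · have hc : ((N - 1 : ℕ) : ℝ) + 1 = N := by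
        rw [Nat.cast_sub (Nat.one_le_of_lt hN), Nat.cast_one, sub_add_cancel]
      simp only [hc]
      exact heq.le

/-- **One uniform step.** For `A, B ≥ 0`, `c, ν, T > 0` there are `h > 0` and `N ≥ 1` with
`T = N h` and Tao's smallness `(A + Bh)⁴ h ≤ c ν³`. [cite: Tao2011, Thm. 5.4 (ii) (arXiv Thm. 31)] -/
private theorem exists_uniform_step {A B c : ℝ} (hA : 0 ≤ A) (hB : 0 ≤ B) (hc : 0 < c)
    (hν : 0 < ν) (hT : 0 < T) :
    ∃ h : ℝ, 0 < h ∧ ∃ N : ℕ, 0 < N ∧ T = N * h ∧ (A + B * h) ^ 4 * h ≤ c * ν ^ 3 := by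
  set D : ℝ := (A + B + 1) ^ 4 with hD
  have hDpos : 0 < D := by positivity
  set h₀ : ℝ := min 1 (c * ν ^ 3 / D) with hh₀
  have hh₀pos : 0 < h₀ := lt_min one_pos (div_pos (by positivity) hDpos)
  have hh₀1 : h₀ ≤ 1 := min_le_left _ _
  have hh₀D : D * h₀ ≤ c * ν ^ 3 := by
    have : h₀ ≤ c * ν ^ 3 / D := min_le_right _ _
    rwa [le_div_iff₀ hDpos, mul_comm] at this
  set N : ℕ := ⌈T / h₀⌉₊ with hN
  have hTN : T / h₀ ≤ N := Nat.le_ceil _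
  have hNpos' : (0 : ℝ) < N := lt_of_lt_of_le (div_pos hT hh₀pos) hTN
  have hNpos : 0 < N := by exact_mod_cast hNpos'
  set h : ℝ := T / N with hh
  have hhpos : 0 < h := div_pos hT hNpos'
  have hhh₀ : h ≤ h₀ := by
    rw [hh, div_le_iff₀ hNpos']
    have := mul_le_mul_of_nonneg_left hTN hh₀pos.le
    rw [mul_div_cancel₀ _ hh₀pos.ne'] at this
    linarith [mul_comm h₀ (N : ℝ)]
  refine ⟨h, hhpos, N, hNpos, by rw [hh, mul_div_cancel₀ _ hNpos'.ne'], ?_⟩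
  have h1 : A + B * h ≤ A + B + 1 := by nlinarith [hhh₀.trans hh₀1]
  calc (A + B * h) ^ 4 * h ≤ D * h := by
        rw [hD]
        exact mul_le_mul_of_nonneg_right (pow_le_pow_left₀ (by positivity) h1 4) hhpos.le
    _ ≤ D * h₀ := by gcongr
    _ ≤ c * ν ^ 3 := hh₀D

/-! ### Plumbing: slices of a Clay force -/

/-- The slices `f t`, `t ≥ 0`, of a force smooth on the closed half-space are smooth. [cite: FeffermanClay2006, (5)-(6)] -/
theorem contDiff_slice_of_halfSpace (hfs : IsSmoothOnHalfSpace f) {t : ℝ} (ht : 0 ≤ t) :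
    ContDiff ℝ ∞ (f t) :=
  (hfs.isSmoothSpaceTimeOn_Icc (t + 1)).contDiff_slice ⟨ht, by linarith⟩

/-- **Pointwise polynomial decay of the slices of a Clay force**: `‖f(t, x)‖ ≤ C_K (1 + ‖x‖)^{-K}`
for all `t ≥ 0`, `x`. [cite: FeffermanClay2006, (5)] -/
theorem exists_norm_slice_le_rpow (hfs : IsSmoothOnHalfSpace f) (hfd : HasRapidSpaceTimeDecay f)
    (K : ℕ) : ∃ C : ℝ, 0 ≤ C ∧ ∀ t, 0 ≤ t → ∀ x, ‖f t x‖ ≤ C * (1 + ‖x‖) ^ (-(K : ℝ)) := by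
  obtain ⟨C, hC0, hC⟩ := hfd.hasUniformRapidDecayOn.norm_iteratedFDerivWithin_le_rpow 0 K
  refine ⟨C, hC0, fun t ht x => ?_⟩
  have h1 := hfs.norm_iteratedFDeriv_slice_le 0 ht x
  rw [norm_iteratedFDeriv_zero] at h1
  exact h1.trans (hC t (mem_Ici.2 ht) x)

/-- The slices of a Clay force are integrable. [cite: FeffermanClay2006, (5)] -/
theorem integrable_slice (hfs : IsSmoothOnHalfSpace f) (hfd : HasRapidSpaceTimeDecay f) {t : ℝ}
    (ht : 0 ≤ t) : Integrable (f t) := by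
  obtain ⟨C, -, hC⟩ := exists_norm_slice_le_rpow hfs hfd 4
  have hr : (Module.finrank ℝ (EuclideanSpace ℝ (Fin 3)) : ℝ) < ((4 : ℕ) : ℝ) := by
    rw [finrank_euclideanSpace_fin]; norm_num
  refine Integrable.mono' ((integrable_one_add_norm hr).const_mul C)
    ((contDiff_slice_of_halfSpace hfs ht).continuous.aestronglyMeasurable) (ae_of_all _ fun x => ?_)
  exact_mod_cast hC t ht x

/-- Uniform `L¹` bound of the slices of a Clay force: `∫ ‖f(t)‖ ≤ L` for `t ≥ 0`. [cite: FeffermanClay2006, (5)] -/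
theorem exists_lintegral_enorm_slice_le (hfs : IsSmoothOnHalfSpace f)
    (hfd : HasRapidSpaceTimeDecay f) :
    ∃ L : ℝ≥0∞, L < ⊤ ∧ ∀ t, 0 ≤ t → ∫⁻ x, ‖f t x‖ₑ ≤ L := by
  obtain ⟨C, hC0, hC⟩ := exists_norm_slice_le_rpow hfs hfd 4
  have hr : (Module.finrank ℝ (EuclideanSpace ℝ (Fin 3)) : ℝ) < (4 : ℝ) := by
    rw [finrank_euclideanSpace_fin]; norm_num
  set I : ℝ≥0∞ := ∫⁻ x : EuclideanSpace ℝ (Fin 3), ENNReal.ofReal ((1 + ‖x‖) ^ (-(4 : ℝ))) with hI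
  refine ⟨ENNReal.ofReal C * I, ENNReal.mul_lt_top ENNReal.ofReal_lt_top
    (finite_integral_one_add_norm hr), fun t ht => ?_⟩
  calc ∫⁻ x, ‖f t x‖ₑ ≤ ∫⁻ x, ENNReal.ofReal C * ENNReal.ofReal ((1 + ‖x‖) ^ (-(4 : ℝ))) := by
        refine lintegral_mono fun x => ?_
        rw [← ofReal_norm, ← ENNReal.ofReal_mul hC0]
        exact ENNReal.ofReal_le_ofReal (by exact_mod_cast hC t ht x)
    _ = ENNReal.ofReal C * I := by rw [hI, lintegral_const_mul' _ _ ENNReal.ofReal_ne_top]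

/-! ### The pressure at order `0` -/

/-- `‖g‖²_{L²} = ∫⁻ ‖g‖ₑ²`. [folklore] -/
private theorem eLpNorm_two_sq' {X : Type*} [MeasurableSpace X] {μ : Measure X} {F : Type*}
    [NormedAddCommGroup F] (g : X → F) : eLpNorm g 2 μ ^ 2 = ∫⁻ x, ‖g x‖ₑ ^ 2 ∂μ := by
  have h := eLpNorm_nnreal_pow_eq_lintegral (f := g) (μ := μ) (p := (2 : NNReal)) two_ne_zero
  simpa only [ENNReal.coe_ofNat, NNReal.coe_ofNat, ENNReal.rpow_two] using h

/-- `‖g‖_{L²} ≤ C^{1/2}` from `∫⁻ ‖g‖ₑ² ≤ C`. [folklore] -/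
private theorem eLpNorm_two_le_rpow_half {X : Type*} [MeasurableSpace X] {μ : Measure X} {F : Type*}
    [NormedAddCommGroup F] {g : X → F} {C : ℝ≥0∞} (h : ∫⁻ x, ‖g x‖ₑ ^ 2 ∂μ ≤ C) :
    eLpNorm g 2 μ ≤ C ^ (2⁻¹ : ℝ) := by
  have h1 : eLpNorm g 2 μ = (eLpNorm g 2 μ ^ 2) ^ ((2 : ℕ)⁻¹ : ℝ) :=
    (ENNReal.pow_rpow_inv_natCast two_ne_zero _).symm
  rw [h1, eLpNorm_two_sq']
  exact ENNReal.rpow_le_rpow h (by norm_num)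

/-- `∫⁻ ‖D⁰g‖ₑ² = ∫⁻ ‖g‖ₑ²`. [folklore] -/
private theorem lintegral_iteratedFDeriv_zero_eq {F : Type*} [NormedAddCommGroup F] [NormedSpace ℝ F]
    (g : EuclideanSpace ℝ (Fin 3) → F) :
    ∫⁻ x, ‖iteratedFDeriv ℝ 0 g x‖ₑ ^ 2 = ∫⁻ x, ‖g x‖ₑ ^ 2 :=
  lintegral_congr fun x => by rw [← ofReal_norm, norm_iteratedFDeriv_zero, ofReal_norm]

/-- **The normalised pressure at order `0`**: for a classical solution on `[0, T]` with all spatial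
Sobolev norms of `u` bounded, Clay force and Tao's normalised pressure
`p = -Δ⁻¹∂ᵢ∂ⱼ(uᵢuⱼ) + Δ⁻¹∇·f`, `‖p(t)‖_{L²}` is bounded on `[0, T]` (Stein's `L²` bound for the
quadratic part by `‖|u|²‖₂ ≤ sup|u| · ‖u‖₂`, Young's inequality for the force potential, both
uniform in `t` by the Clay decay of `f`). [cite: Tao2011, (9) and Thm. 5.4 (iv) (arXiv Thm. 31 (iv))] -/
theorem pressure_order_zero (hsol : IsClassicalNSSolutionOn (Icc 0 T) ν f u p)
    (hE : ∃ C : ℝ≥0, ∀ t ∈ Icc 0 T, ∫⁻ x, ‖u t x‖ₑ ^ 2 ≤ C)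
    (hub : HasBoundedSobolevNormsOn (Icc 0 T) u)
    (hfs : IsSmoothOnHalfSpace f) (hfd : HasRapidSpaceTimeDecay f)
    (hp : HasForcedNormalisedPressure u f p (Icc 0 T)) :
    ∃ C : ℝ≥0, ∀ t ∈ Icc 0 T, ∫⁻ x, ‖iteratedFDeriv ℝ 0 (p t) x‖ₑ ^ 2 ≤ C := by
  -- the sup bound of the velocity
  have hC2 : ∀ t ∈ Icc 0 T, ContDiff ℝ 2 (u t) := fun t ht =>
    (hsol.contDiff_velocity ht).of_le (by norm_cast)
  obtain ⟨Mu, hMu⟩ := linfty_bound_of_hasBoundedSobolevNormsOn_holds hC2 hub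
  obtain ⟨C₀, hC₀⟩ := hE
  -- the force constants
  obtain ⟨L, hLtop, hL⟩ := exists_lintegral_enorm_slice_le hfs hfd
  obtain ⟨F₀, hF₀⟩ := hfd.exists_lintegral_iteratedFDeriv_slice_sq_le_all (μ := volume) hfs 0
  obtain ⟨Mf, -, hMf⟩ := exists_norm_slice_le_rpow hfs hfd 0
  set κ₁ : EuclideanSpace ℝ (Fin 3) → ℝ :=
    (Metric.ball (0 : EuclideanSpace ℝ (Fin 3)) 1).indicator
      fun z : EuclideanSpace ℝ (Fin 3) => (4 * Real.pi * ‖z‖ ^ 2)⁻¹ with hκ₁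
  set κ₂ : EuclideanSpace ℝ (Fin 3) → ℝ :=
    (Metric.ball (0 : EuclideanSpace ℝ (Fin 3)) 1)ᶜ.indicator
      fun z : EuclideanSpace ℝ (Fin 3) => (4 * Real.pi * ‖z‖ ^ 2)⁻¹ with hκ₂
  set K₁ : ℝ≥0∞ := ∫⁻ z, ‖κ₁ z‖ₑ with hK₁
  set K₂ : ℝ≥0∞ := eLpNorm κ₂ 2 volume with hK₂
  have hK₁top : K₁ < ⊤ := integrable_forceMajorant_near.2
  have hK₂top : K₂ < ⊤ := memLp_forceMajorant_far.eLpNorm_lt_top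
  -- the uniform constant
  set K : ℝ≥0∞ := ENNReal.ofReal (27 * regLaplacianMass) *
      (ENNReal.ofReal Mu * (C₀ : ℝ≥0∞) ^ (2⁻¹ : ℝ)) +
    (K₁ * (F₀ : ℝ≥0∞) ^ (2⁻¹ : ℝ) + L * K₂) with hK
  have hKtop : K < ⊤ := by
    refine ENNReal.add_lt_top.2 ⟨ENNReal.mul_lt_top ENNReal.ofReal_lt_top
      (ENNReal.mul_lt_top ENNReal.ofReal_lt_top
        (ENNReal.rpow_lt_top_of_nonneg (by norm_num) ENNReal.coe_ne_top)), ?_⟩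
    exact ENNReal.add_lt_top.2 ⟨ENNReal.mul_lt_top hK₁top
      (ENNReal.rpow_lt_top_of_nonneg (by norm_num) ENNReal.coe_ne_top), ENNReal.mul_lt_top hLtop hK₂top⟩
  refine ⟨(K ^ 2).toNNReal, fun t ht => ?_⟩
  have ht0 : 0 ≤ t := ht.1
  have huc : ContDiff ℝ ∞ (u t) := hsol.contDiff_velocity ht
  -- `u(t) ∈ L²`, `|u(t)|² ∈ L¹`
  have hu2 : eLpNorm (u t) 2 volume ≤ (C₀ : ℝ≥0∞) ^ (2⁻¹ : ℝ) := eLpNorm_two_le_rpow_half (hC₀ t ht)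
  have huMem : MemLp (u t) 2 volume :=
    ⟨huc.continuous.aestronglyMeasurable,
      hu2.trans_lt (ENNReal.rpow_lt_top_of_nonneg (by norm_num) ENNReal.coe_ne_top)⟩
  have hint : Integrable (fun y => ‖u t y‖ ^ 2) volume :=
    (memLp_two_iff_integrable_sq_norm huc.continuous.aestronglyMeasurable).1 huMem
  -- the quadratic part
  have hN : eLpNorm (normalisedPressure (u t)) 2 volume ≤
      ENNReal.ofReal (27 * regLaplacianMass) * (ENNReal.ofReal Mu * (C₀ : ℝ≥0∞) ^ (2⁻¹ : ℝ)) := by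
    refine (eLpNorm_normalisedPressure_le_of_integrable huc hint).trans ?_
    gcongr
    have hsq : eLpNorm (fun y => ‖u t y‖ ^ 2) 2 volume ≤ ENNReal.ofReal Mu * eLpNorm (u t) 2 volume := by
      refine eLpNorm_le_mul_eLpNorm_of_ae_le_mul (ae_of_all _ fun y => ?_) 2
      rw [Real.norm_of_nonneg (sq_nonneg _), sq]
      exact mul_le_mul_of_nonneg_right (hMu t ht y) (norm_nonneg _)
    exact hsq.trans (by gcongr)
  -- the force potential
  have hfc : Continuous (f t) := (contDiff_slice_of_halfSpace hfs ht0).continuous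
  have hfM : ∀ x, ‖f t x‖ ≤ Mf := fun x => by simpa using hMf t ht0 x
  have hf2 : eLpNorm (f t) 2 volume ≤ (F₀ : ℝ≥0∞) ^ (2⁻¹ : ℝ) := by
    refine eLpNorm_two_le_rpow_half ?_
    rw [← lintegral_iteratedFDeriv_zero_eq]
    exact hF₀ t ht0
  have hΦ : eLpNorm (forcePotential (f t)) 2 volume ≤ K₁ * (F₀ : ℝ≥0∞) ^ (2⁻¹ : ℝ) + L * K₂ := by
    refine (eLpNorm_forcePotential_le hfc (integrable_slice hfs hfd ht0) hfM).trans ?_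
    exact add_le_add (mul_le_mul_right hf2 _) (mul_le_mul_left (hL t ht0) _)
  -- triangle inequality
  have hpt : p t = normalisedPressure (u t) + forcePotential (f t) := funext fun x => hp t ht x
  have hNm : AEStronglyMeasurable (normalisedPressure (u t)) volume :=
    aestronglyMeasurable_normalisedPressure_of_integrable huc hint
  have hΦm : AEStronglyMeasurable (forcePotential (f t)) volume :=
    aestronglyMeasurable_forcePotential hfc.measurable
  have hpK : eLpNorm (p t) 2 volume ≤ K := by
    rw [hpt]
    exact (eLpNorm_add_le hNm hΦm one_le_two).trans (add_le_add hN hΦ)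
  rw [lintegral_iteratedFDeriv_zero_eq, ← eLpNorm_two_sq', ENNReal.coe_toNNReal (ENNReal.pow_ne_top hKtop.ne)]
  exact pow_le_pow_left' hpK 2

/-! ### The main theorem -/

/-- **One restart piece.** On the sub-slab `[τ, τ + h] ⊆ [0, T]` (`(A + Bh)⁴h ≤ cν³`, `A`, `B` the
uniform `H¹` bounds of `u(·)` and `f(·)`), the forced local existence theorem F2 produces a
Tao-class solution from the datum `u(τ)` and the shifted force, which coincides with the shifted
flow (uniqueness of classical solutions with bounded Sobolev norms); hence `∂ₜu` and `∇p` are of Tao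
class on the piece. [cite: Tao2011, Thm. 5.4 (ii)+(iv) (arXiv Thm. 31) and Cor. 11.1] -/
theorem piece {c A B : ℝ}
    (hloc : ∀ ⦃ν T : ℝ⦄, 0 < ν → 0 < T →
      ∀ ⦃u₀ : EuclideanSpace ℝ (Fin 3) → EuclideanSpace ℝ (Fin 3)⦄,
        ContDiff ℝ ∞ u₀ → VectorCalculus.IsDivFree u₀ →
        (∀ n : ℕ, ∫⁻ x, ‖iteratedFDeriv ℝ n u₀ x‖ₑ ^ 2 < ⊤) →
      ∀ ⦃f : ℝ → EuclideanSpace ℝ (Fin 3) → EuclideanSpace ℝ (Fin 3)⦄,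
        FluidPDE.IsSmoothSpaceTimeOn (Icc 0 T) f → FluidPDE.HasUniformRapidDecayOn (Icc 0 T) f →
        ∀ ⦃A B : ℝ⦄, 0 ≤ A → 0 ≤ B →
          (∫⁻ x, ‖u₀ x‖ₑ ^ 2) + (∫⁻ x, ENNReal.ofReal (FluidPDE.frobeniusNormSq (fderiv ℝ u₀ x))) ≤
              ENNReal.ofReal (A ^ 2) →
          (∀ t ∈ Icc 0 T,
            (∫⁻ x, ‖f t x‖ₑ ^ 2) + (∫⁻ x, ENNReal.ofReal (FluidPDE.frobeniusNormSq (fderiv ℝ (f t) x))) ≤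
              ENNReal.ofReal (B ^ 2)) →
          (A + B * T) ^ 4 * T ≤ c * ν ^ 3 →
          ∃ (u : ℝ → EuclideanSpace ℝ (Fin 3) → EuclideanSpace ℝ (Fin 3))
            (p : ℝ → EuclideanSpace ℝ (Fin 3) → ℝ),
            FluidPDE.IsClassicalNSSolutionOn (Icc 0 T) ν f u p ∧ u 0 = u₀ ∧
            HasBoundedSobolevNormsOn (Icc 0 T) u ∧
            HasBoundedSobolevNormsOn (Icc 0 T) (FluidPDE.timeDerivWithin (Icc 0 T) u) ∧
            (∀ n : ℕ, ∃ C : ℝ≥0, ∀ t ∈ Icc 0 T, ∫⁻ x, ‖iteratedFDeriv ℝ n (p t) x‖ₑ ^ 2 ≤ C) ∧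
            FluidPDE.ContinuousInLpOn (Icc 0 T) 2 u)
    (hν : 0 < ν) (hsol : IsClassicalNSSolutionOn (Icc 0 T) ν f u p)
    (hub : HasBoundedSobolevNormsOn (Icc 0 T) u)
    (hfs : IsSmoothOnHalfSpace f) (hfd : HasRapidSpaceTimeDecay f)
    (hA : 0 ≤ A) (hB : 0 ≤ B)
    (hAu : ∀ τ ∈ Icc 0 T, (∫⁻ x, ‖u τ x‖ₑ ^ 2) +
      (∫⁻ x, ENNReal.ofReal (FluidPDE.frobeniusNormSq (fderiv ℝ (u τ) x))) ≤ ENNReal.ofReal (A ^ 2))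
    (hBf : ∀ t, 0 ≤ t → (∫⁻ x, ‖f t x‖ₑ ^ 2) +
      (∫⁻ x, ENNReal.ofReal (FluidPDE.frobeniusNormSq (fderiv ℝ (f t) x))) ≤ ENNReal.ofReal (B ^ 2))
    {h : ℝ} (hh : 0 < h) (hsmall : (A + B * h) ^ 4 * h ≤ c * ν ^ 3)
    {τ : ℝ} (hτ : 0 ≤ τ) (hτh : τ + h ≤ T) :
    ∃ D₁ D₂ : ℕ → ℝ≥0, ∀ t ∈ Icc τ (τ + h),
      (∀ n, ∫⁻ x, ‖iteratedFDeriv ℝ n (timeDerivWithin (Icc 0 T) u t) x‖ₑ ^ 2 ≤ D₁ n) ∧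
      (∀ n, ∫⁻ x, ‖iteratedFDeriv ℝ (n + 1) (p t) x‖ₑ ^ 2 ≤ D₂ n) := by
  have hτT : τ ∈ Icc 0 T := ⟨hτ, by linarith⟩
  -- F2 on the piece
  obtain ⟨v, q, hsol', hv0, hvb, hvt, hq, -⟩ := hloc hν hh (hsol.contDiff_velocity hτT)
    (hsol.divFree τ hτT) (fun n => by obtain ⟨C, hC⟩ := hub n; exact (hC τ hτT).trans_lt ENNReal.coe_lt_top)
    (hfs.isSmoothSpaceTimeOn_Icc_timeShift hτ h) (hfd.hasUniformRapidDecayOn_Icc_timeShift hfs hτ hh)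
    hA hB (hAu τ hτT) (fun s hs => hBf (s + τ) (by linarith [hs.1])) hsmall
  -- the shifted flow and uniqueness
  have hshift := shift_Icc hsol hτ hh hτh
  have heqv : ∀ s ∈ Icc 0 h, u (s + τ) = v s := by
    have h0 : (fun s => u (s + τ)) 0 = v 0 := by simp [hv0]
    exact hshift.velocity_eq_of_hasBoundedSobolevNormsOn hsol' hν.le hh
      (hasBoundedSobolevNormsOn_shift hub hτ hτh) hvb h0
  -- constants
  choose D₁ hD₁ using hvt
  choose D₂ hD₂ using hq
  refine ⟨D₁, fun n => D₂ (n + 1), fun t ht => ⟨fun n => ?_, fun n => ?_⟩⟩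
  · -- the time derivative
    have hts : t - τ ∈ Icc 0 h := ⟨by linarith [ht.1], by linarith [ht.2]⟩
    rw [timeDerivWithin_eq_shift hsol.smooth_velocity hτ hh hτh heqv ht]
    exact hD₁ n (t - τ) hts
  · -- the pressure gradient
    have hts : t - τ ∈ Icc 0 h := ⟨by linarith [ht.1], by linarith [ht.2]⟩
    have hfd' : fderiv ℝ (p t) = fderiv ℝ (q (t - τ)) := by
      have := fderiv_pressure_eq hshift hsol' heqv hts
      simpa only [sub_add_cancel] using this
    rw [lintegral_iteratedFDeriv_succ_eq_of_fderiv_eq hfd' n]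
    exact hD₂ (n + 1) (t - τ) hts

end TaoForcedJ1

open TaoForcedJ1 in
/-- **Tao 2013, Cor. 11.1 + Cor. 4.3 + Thm. 5.4 (iv) WITH force, from forced smooth local existence.**
The named fact `tao2011_hasBoundedSobolevNormsOn_forced` (`u, ∂ₜu, p ∈ L^∞_t H^k_x([0, T] × ℝ³)`
for a finite-energy classical solution on the closed slab with Schwartz datum, Clay force and
Tao-normalised pressure) follows from the forced local existence theorem
`tao2011_smooth_local_existence_forced` (Thm. 5.4 (ii)+(iv)): the spatial clause is the tree's
fact-free `hasBoundedSobolevNormsOn_of_clayForce`; it gives ONE uniform restart step, on each piece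
the local solution is the flow (uniqueness with bounded Sobolev norms), which transports the `∂ₜu`
and `∇p` classes; the order-`0` pressure bound is Stein's `L²` bound + Young for the normalised
pressure. [cite: Tao2011, Cor. 11.1 + Cor. 4.3 + Thm. 5.4 (ii)+(iv) (arXiv Cor. 68, Cor. 26, Thm. 31)] -/
theorem tao2011_hasBoundedSobolevNormsOn_forced_of_smooth_local_existence
    (hF : tao2011_smooth_local_existence_forced) : tao2011_hasBoundedSobolevNormsOn_forced := by
  intro ν T hν hT f u p hsol hE h₀ hfs hfd hp
  have hub : HasBoundedSobolevNormsOn (Icc 0 T) u :=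
    hsol.hasBoundedSobolevNormsOn_of_clayForce hν hT hE h₀ hfs hfd
  obtain ⟨c, hc, hloc⟩ := hF
  -- uniform `H¹` bounds of the velocity and of the force
  obtain ⟨C₀, hC₀⟩ := hub 0
  obtain ⟨C₁, hC₁⟩ := hub 1
  obtain ⟨F₀, hF₀⟩ := hfd.exists_lintegral_iteratedFDeriv_slice_sq_le_all (μ := volume) hfs 0
  obtain ⟨F₁, hF₁⟩ := hfd.exists_lintegral_iteratedFDeriv_slice_sq_le_all (μ := volume) hfs 1
  set A : ℝ := Real.sqrt (C₀ + 3 * C₁) with hAdef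
  set B : ℝ := Real.sqrt (F₀ + 3 * F₁) with hBdef
  have hA : 0 ≤ A := Real.sqrt_nonneg _
  have hB : 0 ≤ B := Real.sqrt_nonneg _
  have hH1 : ∀ {g : EuclideanSpace ℝ (Fin 3) → EuclideanSpace ℝ (Fin 3)} {G₀ G₁ : ℝ≥0},
      ∫⁻ x, ‖iteratedFDeriv ℝ 0 g x‖ₑ ^ 2 ≤ G₀ → ∫⁻ x, ‖iteratedFDeriv ℝ 1 g x‖ₑ ^ 2 ≤ G₁ →
      (∫⁻ x, ‖g x‖ₑ ^ 2) + (∫⁻ x, ENNReal.ofReal (FluidPDE.frobeniusNormSq (fderiv ℝ g x))) ≤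
        ENNReal.ofReal ((Real.sqrt (G₀ + 3 * G₁)) ^ 2) := by
    intro g G₀ G₁ h0 h1
    rw [Real.sq_sqrt (by positivity), ENNReal.ofReal_add (by positivity) (by positivity),
      ENNReal.ofReal_coe_nnreal, ENNReal.ofReal_mul (by norm_num), ENNReal.ofReal_coe_nnreal,
      show ENNReal.ofReal (3 : ℝ) = 3 by norm_num]
    refine add_le_add (by rwa [← lintegral_iteratedFDeriv_zero_eq]) ?_
    calc ∫⁻ x, ENNReal.ofReal (FluidPDE.frobeniusNormSq (fderiv ℝ g x))
        ≤ ∫⁻ x, 3 * ‖iteratedFDeriv ℝ 1 g x‖ₑ ^ 2 := lintegral_mono fun x => by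
          rw [← ofReal_norm, norm_iteratedFDeriv_one, ofReal_norm]
          exact ofReal_frobeniusNormSq_le_three_mul_enorm_sq _
      _ = 3 * ∫⁻ x, ‖iteratedFDeriv ℝ 1 g x‖ₑ ^ 2 := lintegral_const_mul' _ _ (by norm_num)
      _ ≤ 3 * G₁ := by gcongr
  have hAu : ∀ τ ∈ Icc 0 T, (∫⁻ x, ‖u τ x‖ₑ ^ 2) +
      (∫⁻ x, ENNReal.ofReal (FluidPDE.frobeniusNormSq (fderiv ℝ (u τ) x))) ≤ ENNReal.ofReal (A ^ 2) :=
    fun τ hτ => hH1 (hC₀ τ hτ) (hC₁ τ hτ)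
  have hBf : ∀ t, 0 ≤ t → (∫⁻ x, ‖f t x‖ₑ ^ 2) +
      (∫⁻ x, ENNReal.ofReal (FluidPDE.frobeniusNormSq (fderiv ℝ (f t) x))) ≤ ENNReal.ofReal (B ^ 2) :=
    fun t ht => hH1 (hF₀ t ht) (hF₁ t ht)
  -- one uniform step
  obtain ⟨h, hh, N, hN, hTN, hsmall⟩ := exists_uniform_step (T := T) hA hB hc hν hT
  -- the pieces
  have hpiece : ∀ k : Fin N, ∃ D : (ℕ → ℝ≥0) × (ℕ → ℝ≥0),
      ∀ t ∈ Icc ((k : ℕ) * h) (((k : ℕ) + 1) * h),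
        (∀ n, ∫⁻ x, ‖iteratedFDeriv ℝ n (timeDerivWithin (Icc 0 T) u t) x‖ₑ ^ 2 ≤ D.1 n) ∧
        (∀ n, ∫⁻ x, ‖iteratedFDeriv ℝ (n + 1) (p t) x‖ₑ ^ 2 ≤ D.2 n) := by
    intro k
    have hk0 : 0 ≤ (k : ℕ) * h := by positivity
    have hk1 : (k : ℕ) * h + h ≤ T := by
      have : ((k : ℕ) : ℝ) + 1 ≤ N := by exact_mod_cast Nat.succ_le_of_lt k.2
      rw [hTN]; nlinarith
    obtain ⟨D₁, D₂, hD⟩ := piece hloc hν hsol hub hfs hfd hA hB hAu hBf hh hsmall hk0 hk1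
    refine ⟨(D₁, D₂), fun t ht => hD t ⟨ht.1, by linarith [ht.2]⟩⟩
  choose D hD using hpiece
  have hcover : ∀ t ∈ Icc 0 T, ∃ k : Fin N, t ∈ Icc ((k : ℕ) * h) (((k : ℕ) + 1) * h) :=
    fun t ht => exists_step hh hN (by rwa [← hTN])
  refine ⟨hub, fun n => ⟨∑ k : Fin N, (D k).1 n, fun t ht => ?_⟩, fun n => ?_⟩
  · obtain ⟨k, hk⟩ := hcover t ht
    refine ((hD k t hk).1 n).trans ?_
    exact_mod_cast Finset.single_le_sum (f := fun k => (D k).1 n) (fun i _ => zero_le)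
      (Finset.mem_univ k)
  · cases n with
    | zero => exact pressure_order_zero hsol hE hub hfs hfd hp
    | succ n =>
      refine ⟨∑ k : Fin N, (D k).2 n, fun t ht => ?_⟩
      obtain ⟨k, hk⟩ := hcover t ht
      refine ((hD k t hk).2 n).trans ?_
      exact_mod_cast Finset.single_le_sum (f := fun k => (D k).2 n) (fun i _ => zero_le)
        (Finset.mem_univ k)

end Literature.Analysis.FluidPDE

end
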